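import Summits.CriticalPhenomena.PercolationContinuityZ3.Theorems.PercNearOneGluingNoHeavyLowerTailTwoPartitionHallForm
import HarnessLib.Audit

/-!
# `NoHeavyLowerTail` (crux stmt-CriticalPhenomena-4575), master-family hierarchy P3 (gen 32): the TWO-UP-SET CORE of the Hall-form tower —
# `ThreeSetHallD` (a Kleitman inequality with a relative down-set) is EQUIVALENT to `ThreeSetHallG2` and implies `ThreeSetAntipodal`

Support file (seat `prim-masterthm-p3`; `--supports stmt-CriticalPhenomena-4575`; memo
`run/shared/lean/prim/prim-masterthm/FROM-prim-masterthm-p3-g32-HALL-CORE.md`, HIERARCHY §39).  Companion of `…TwoPartitionHallForm`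
(`ThreeSetHall ⊂ ThreeSetHallG ⊂ ThreeSetHallG2`, four up-sets `𝒲, 𝒳, 𝒴, 𝒵` with two side conditions).

**THE CORE FORM** (`ThreeSetHallD`, CONJECTURE, this work).  For up-sets `𝒲, 𝒰 ⊆ 𝒱` of a finite cube and a down-set `𝒟` with
`𝒱 ∩ 𝒟 ⊆ 𝒰` (equivalently: `ℰ := 𝒱 ∩ 𝒟` is a relative down-set of `𝒱`, `𝒰 ⊇ ↑ℰ`, `𝒟 ⊇ ↓ℰ`):

  `twoPartN 𝒲 𝒱 = #(𝒲 ∩ 𝒱) − #(𝒲 ∩ 𝒱ᶜˢ) ≥ #(𝒲 ∩ 𝒟 ∩ 𝒰) − #(𝒲 ∩ 𝒟 ∩ 𝒰ᶜˢ)`,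

i.e. the Harris–Kleitman slack of `(𝒲, 𝒱)` dominates the same two-partition count RESTRICTED to the down-set `𝒟` and taken for the
smaller up-set `𝒰` ("`Kl(𝒲, 𝒱) ≥ Kl(𝒲 ∩ 𝒟, 𝒰)`").  `𝒟 = ∅` is Harris–Kleitman; `𝒰 = 𝒱` is Harris–Kleitman for the up-set `𝒲 ∖ 𝒟`
(`threeSetHallD_face_empty`, `threeSetHallD_face_eq`); `𝒟 = ⊤` forces `𝒰 = 𝒱` (equality).  The strongest instance for a given relative
down-set `ℰ` of `𝒱` is `𝒰 = ↑ℰ`, `𝒟 = ↓ℰ`:  `Kl(𝒲,𝒱) ≥ #(𝒲 ∩ ℰ) − #{S ∈ 𝒲 : S ⊆ e, Sᶜ ⊇ e' for some e, e' ∈ ℰ}`.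
**EQUIVALENCE** (kernel, this file): `ThreeSetHallD ↔ ThreeSetHallG2` (`threeSetHallG2_of_threeSetHallD`: instantiate the core at
`𝒱 := 𝒴 ∪ 𝒵, 𝒰 := 𝒵, 𝒟 := (𝒲 ∩ 𝒳 ∪ 𝒴)ᶜ`; `threeSetHallD_of_threeSetHallG2`: instantiate `G″` at `𝒳 := 𝒟ᶜ, 𝒴 := 𝒱 ∖ 𝒟, 𝒵 := 𝒰`), hence
`ThreeSetHallD → ThreeSetHall → ThreeSetAntipodal` (⟹ SQKD).  So the whole Hall-form tower is ONE statement about a pair of nested up-sets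
`𝒰 ⊆ 𝒱`, a down-set `𝒟` and a test up-set `𝒲`; by P. Hall it says that `{S : Sᶜ ∈ 𝒱} ∖ {S ∈ 𝒟 : Sᶜ ∈ 𝒰}` minus `𝒱 ∖ 𝒟`… precisely: the
family `(𝒱ᶜˢ ∖ (𝒱∖𝒟)) ∖ (𝒟 ∩ 𝒰ᶜˢ)` injects into `(𝒱 ∖ 𝒟) ∖ 𝒱ᶜˢ` along `S ↦ φ S ⊇ S`.
EVIDENCE (not in the kernel; seat folder `code/g6.c`, kit job j283728): in Hall (matching) form the core holds for EVERY pair of nested up-sets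
`𝒴 ⊆ 𝒱` of `2^[n]`, `n ≤ 5` (n = 5: all 7 828 354 pairs, hence for all `𝒲`; 4 s), and for `2.3·10⁶` random pairs on `2^[6]`; it also holds with
the antipode `S ↦ Sᶜ` replaced by any anti-automorphism `S ↦ ρ(Sᶜ)` of `2^[4]` (exhaustive), and FAILS when `ℰ` and its mirror are decoupled.
HONEST LABEL: a conjecture (obligation, never a fact), two equivalences and two easy faces; `ThreeSetHallD`, `ThreeSetHallG2`,
`ThreeSetAntipodal`, SQKD remain OPEN. [this work]
-/

namespace Summit.CriticalPhenomena.PercolationContinuityZ3.Theorems.TwoPartition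

open Finset
open scoped FinsetFamily

/-! ### The core form of the conjecture -/

/-- **CONJECTURE `ThreeSetHallD`** (this work; open): for up-sets `𝒲, 𝒰 ⊆ 𝒱` of a finite cube and a down-set `𝒟` with `𝒱 ∩ 𝒟 ⊆ 𝒰`,
`#(𝒲 ∩ 𝒟 ∩ 𝒰) − #(𝒲 ∩ 𝒟 ∩ 𝒰ᶜˢ) ≤ twoPartN 𝒲 𝒱 = #(𝒲 ∩ 𝒱) − #(𝒲 ∩ 𝒱ᶜˢ)`: the Harris–Kleitman slack of `(𝒲, 𝒱)` dominates the
two-partition count of the smaller up-set `𝒰` restricted to `𝒟`.  Equivalent to `ThreeSetHallG2` (this file); implies `ThreeSetAntipodal`.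
Verified (Hall form) for all nested pairs of up-sets of `2^[n]`, `n ≤ 5`.  An obligation / hypothesis — never a fact. [this work] [status: open] -/
@[conjecture] def ThreeSetHallD : Prop :=
  ∀ (n : ℕ) (𝒲 𝒰 𝒱 𝒟 : Finset (Finset (Fin n))), IsUpperSet (𝒲 : Set (Finset (Fin n))) → IsUpperSet (𝒰 : Set (Finset (Fin n))) →
    IsUpperSet (𝒱 : Set (Finset (Fin n))) → IsLowerSet (𝒟 : Set (Finset (Fin n))) → 𝒰 ⊆ 𝒱 → 𝒱 ∩ 𝒟 ⊆ 𝒰 →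
    (#(𝒲 ∩ 𝒟 ∩ 𝒰) : ℤ) - #(𝒲 ∩ 𝒟 ∩ 𝒰ᶜˢ) ≤ twoPartN 𝒲 𝒱

/-! ### Two easy faces of the core form (Harris–Kleitman) -/

/-- Face `𝒟 = ∅` of `ThreeSetHallD`: this is Harris–Kleitman `0 ≤ twoPartN 𝒲 𝒱`. [this work] -/
theorem threeSetHallD_face_empty {n : ℕ} {𝒲 𝒰 𝒱 : Finset (Finset (Fin n))} (h𝒲 : IsUpperSet (𝒲 : Set (Finset (Fin n))))
    (h𝒱 : IsUpperSet (𝒱 : Set (Finset (Fin n)))) :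
    (#(𝒲 ∩ ∅ ∩ 𝒰) : ℤ) - #(𝒲 ∩ ∅ ∩ 𝒰ᶜˢ) ≤ twoPartN 𝒲 𝒱 := by
  rw [inter_empty, empty_inter, empty_inter, card_empty]
  have h := twoPartN_nonneg h𝒲 h𝒱
  omega

/-- Face `𝒰 = 𝒱` of `ThreeSetHallD`: `twoPartN 𝒲 𝒱 − (#(𝒲 ∩ 𝒟 ∩ 𝒱) − #(𝒲 ∩ 𝒟 ∩ 𝒱ᶜˢ)) = twoPartN (𝒲 ∖ 𝒟) 𝒱 ≥ 0`, Harris–Kleitman for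
the up-set `𝒲 ∖ 𝒟`. [this work] -/
theorem threeSetHallD_face_eq {n : ℕ} {𝒲 𝒱 𝒟 : Finset (Finset (Fin n))} (h𝒲 : IsUpperSet (𝒲 : Set (Finset (Fin n))))
    (h𝒱 : IsUpperSet (𝒱 : Set (Finset (Fin n)))) (h𝒟 : IsLowerSet (𝒟 : Set (Finset (Fin n)))) :
    (#(𝒲 ∩ 𝒟 ∩ 𝒱) : ℤ) - #(𝒲 ∩ 𝒟 ∩ 𝒱ᶜˢ) ≤ twoPartN 𝒲 𝒱 := by
  have hup : IsUpperSet ((𝒲 \ 𝒟 : Finset (Finset (Fin n))) : Set (Finset (Fin n))) := by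
    rw [coe_sdiff]; exact h𝒲.sdiff_of_isLowerSet h𝒟
  have h := twoPartN_nonneg hup h𝒱
  unfold twoPartN at h ⊢
  have e1 : #((𝒲 \ 𝒟) ∩ 𝒱) + #(𝒲 ∩ 𝒟 ∩ 𝒱) = #(𝒲 ∩ 𝒱) := by
    rw [← card_union_of_disjoint (disjoint_left.2 fun S h1 h2 => (mem_sdiff.1 (mem_inter.1 h1).1).2 (mem_inter.1 (mem_inter.1 h2).1).2)]
    congr 1; ext S; simp only [mem_union, mem_inter, mem_sdiff]; tauto
  have e2 : #((𝒲 \ 𝒟) ∩ 𝒱ᶜˢ) + #(𝒲 ∩ 𝒟 ∩ 𝒱ᶜˢ) = #(𝒲 ∩ 𝒱ᶜˢ) := by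
    rw [← card_union_of_disjoint (disjoint_left.2 fun S h1 h2 => (mem_sdiff.1 (mem_inter.1 h1).1).2 (mem_inter.1 (mem_inter.1 h2).1).2)]
    congr 1; ext S; simp only [mem_union, mem_inter, mem_sdiff]; tauto
  omega

/-! ### `ThreeSetHallD → ThreeSetHallG2` -/

/-- **`ThreeSetHallD → ThreeSetHallG2`** (this work): given `𝒲, 𝒳, 𝒴, 𝒵` as in `G″`, apply the core form to `𝒱 := 𝒴 ∪ 𝒵`, `𝒰 := 𝒵`,
`𝒟 := (𝒲 ∩ 𝒳 ∪ 𝒴)ᶜ`; the side condition `(𝒴 ∪ 𝒵) ∩ 𝒟 ⊆ 𝒵` is automatic and the two `G″`-hypotheses turn the four counts of the core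
into the three counts of `G″`. [this work] -/
theorem threeSetHallG2_of_threeSetHallD (h : ThreeSetHallD) : ThreeSetHallG2 := by
  intro n 𝒲 𝒳 𝒴 𝒵 h𝒲 h𝒳 h𝒴 h𝒵 hXZ hW
  -- the down-set `𝒟 := (𝒲 ∩ 𝒳 ∪ 𝒴)ᶜ`
  have hWX : IsUpperSet ((𝒲 ∩ 𝒳 : Finset (Finset (Fin n))) : Set (Finset (Fin n))) := isUpperSet_inter' h𝒲 h𝒳
  have hup : IsUpperSet ((𝒲 ∩ 𝒳 ∪ 𝒴 : Finset (Finset (Fin n))) : Set (Finset (Fin n))) := by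
    rw [coe_union]; exact hWX.union h𝒴
  have hD : IsLowerSet (((𝒲 ∩ 𝒳 ∪ 𝒴)ᶜ : Finset (Finset (Fin n))) : Set (Finset (Fin n))) := by
    rw [coe_compl]; exact hup.compl
  have hV : IsUpperSet ((𝒴 ∪ 𝒵 : Finset (Finset (Fin n))) : Set (Finset (Fin n))) := by
    rw [coe_union]; exact h𝒴.union h𝒵
  have hUV : 𝒵 ⊆ 𝒴 ∪ 𝒵 := subset_union_right
  have hVD : (𝒴 ∪ 𝒵) ∩ (𝒲 ∩ 𝒳 ∪ 𝒴)ᶜ ⊆ 𝒵 := by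
    intro S hS
    simp only [mem_inter, mem_union, mem_compl, not_or] at hS
    exact hS.1.resolve_left hS.2.2
  have key := h n 𝒲 𝒵 (𝒴 ∪ 𝒵) (𝒲 ∩ 𝒳 ∪ 𝒴)ᶜ h𝒲 h𝒵 hV hD hUV hVD
  unfold twoPartN at key
  -- hypotheses in membership form
  have hXZ' : ∀ S, S ∈ 𝒳 → S ∈ 𝒵 → S ∈ 𝒴 := fun S hx hz => (mem_inter.1 (hXZ (mem_inter.2 ⟨hx, hz⟩))).2
  have hW' : ∀ S, S ∈ 𝒲 → S ∈ 𝒴 → S ∈ 𝒳 := fun S hw hy => (mem_inter.1 (hW (mem_inter.2 ⟨hw, hy⟩))).1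
  -- f1: `#(𝒲 ∩ (𝒴 ∪ 𝒵)) = #(𝒲 ∩ 𝒴) + #(𝒲 ∩ 𝒵 \ 𝒴)`
  have f1 : #(𝒲 ∩ (𝒴 ∪ 𝒵)) = #(𝒲 ∩ 𝒴) + #((𝒲 ∩ 𝒵) \ 𝒴) := by
    rw [← card_union_of_disjoint (disjoint_left.2 fun S h1 h2 => (mem_sdiff.1 h2).2 (mem_inter.1 h1).2)]
    congr 1; ext S; simp only [mem_union, mem_inter, mem_sdiff]; tauto
  -- f2: `#(𝒲 ∩ (𝒴 ∪ 𝒵)ᶜˢ) = #(𝒲 ∩ (𝒴 \ 𝒵)ᶜˢ) + #(𝒲 ∩ 𝒵ᶜˢ)`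
  have f2 : #(𝒲 ∩ (𝒴 ∪ 𝒵)ᶜˢ) = #(𝒲 ∩ (𝒴 \ 𝒵)ᶜˢ) + #(𝒲 ∩ 𝒵ᶜˢ) := by
    rw [← card_union_of_disjoint (disjoint_left.2 fun S h1 h2 => by
      have a := mem_compls.1 (mem_inter.1 h1).2; have b := mem_compls.1 (mem_inter.1 h2).2
      exact (mem_sdiff.1 a).2 b)]
    congr 1; ext S; simp only [mem_union, mem_inter, mem_compls, mem_sdiff]; tauto
  -- f3: `𝒲 ∩ 𝒟 ∩ 𝒵 = (𝒲 ∩ 𝒵) \ 𝒴` (uses `𝒳 ∩ 𝒵 ⊆ 𝒴`)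
  have f3 : 𝒲 ∩ (𝒲 ∩ 𝒳 ∪ 𝒴)ᶜ ∩ 𝒵 = (𝒲 ∩ 𝒵) \ 𝒴 := by
    ext S; simp only [mem_inter, mem_compl, mem_union, mem_sdiff, not_or, not_and]
    constructor
    · rintro ⟨⟨hw, -, hny⟩, hz⟩; exact ⟨⟨hw, hz⟩, hny⟩
    · rintro ⟨⟨hw, hz⟩, hny⟩; exact ⟨⟨hw, fun _ hx => hny (hXZ' S hx hz), hny⟩, hz⟩
  -- f4: `#(𝒲 ∩ 𝒟 ∩ 𝒵ᶜˢ) + #(𝒲 ∩ 𝒳 ∩ 𝒵ᶜˢ) = #(𝒲 ∩ 𝒵ᶜˢ)` (uses `𝒲 ∩ 𝒴 ⊆ 𝒳`)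
  have f4 : #(𝒲 ∩ (𝒲 ∩ 𝒳 ∪ 𝒴)ᶜ ∩ 𝒵ᶜˢ) + #(𝒲 ∩ 𝒳 ∩ 𝒵ᶜˢ) = #(𝒲 ∩ 𝒵ᶜˢ) := by
    rw [← card_union_of_disjoint (disjoint_left.2 fun S h1 h2 => by
      have a := mem_inter.1 (mem_inter.1 h1).1
      simp only [mem_compl, mem_union, not_or, mem_inter] at a
      exact a.2.1 ⟨a.1, (mem_inter.1 (mem_inter.1 h2).1).2⟩)]
    congr 1; ext S; simp only [mem_union, mem_inter, mem_compl, not_or, mem_compls]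
    constructor
    · rintro (⟨⟨hw, -, -⟩, hz⟩ | ⟨⟨hw, -⟩, hz⟩) <;> exact ⟨hw, hz⟩
    · rintro ⟨hw, hz⟩
      by_cases hx : S ∈ 𝒳
      · exact Or.inr ⟨⟨hw, hx⟩, hz⟩
      · exact Or.inl ⟨⟨hw, fun h' => hx h'.2, fun hy => hx (hW' S hw hy)⟩, hz⟩
  -- f5: `𝒲 ∩ 𝒳 ∩ 𝒴 = 𝒲 ∩ 𝒴`
  have f5 : 𝒲 ∩ 𝒳 ∩ 𝒴 = 𝒲 ∩ 𝒴 := by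
    ext S; simp only [mem_inter]
    constructor
    · rintro ⟨⟨hw, -⟩, hy⟩; exact ⟨hw, hy⟩
    · rintro ⟨hw, hy⟩; exact ⟨⟨hw, hW' S hw hy⟩, hy⟩
  rw [f3] at key
  rw [f5]
  omega

/-! ### `ThreeSetHallG2 → ThreeSetHallD` -/

/-- **`ThreeSetHallG2 → ThreeSetHallD`** (this work): given `𝒲, 𝒰 ⊆ 𝒱, 𝒟` as in the core form, apply `G″` to `𝒳 := 𝒟ᶜ`,
`𝒴 := 𝒱 ∖ 𝒟`, `𝒵 := 𝒰`. [this work] -/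
theorem threeSetHallD_of_threeSetHallG2 (h : ThreeSetHallG2) : ThreeSetHallD := by
  intro n 𝒲 𝒰 𝒱 𝒟 h𝒲 h𝒰 h𝒱 h𝒟 hUV hVD
  have hX : IsUpperSet ((𝒟ᶜ : Finset (Finset (Fin n))) : Set (Finset (Fin n))) := by
    rw [coe_compl]; exact h𝒟.compl
  have hY : IsUpperSet ((𝒱 \ 𝒟 : Finset (Finset (Fin n))) : Set (Finset (Fin n))) := by
    rw [coe_sdiff]; exact h𝒱.sdiff_of_isLowerSet h𝒟
  have h1 : 𝒟ᶜ ∩ 𝒰 ⊆ 𝒟ᶜ ∩ (𝒱 \ 𝒟) := by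
    intro S hS
    simp only [mem_inter, mem_compl, mem_sdiff] at hS ⊢
    exact ⟨hS.1, hUV hS.2, hS.1⟩
  have h2 : 𝒲 ∩ (𝒱 \ 𝒟) ⊆ 𝒟ᶜ ∩ (𝒱 \ 𝒟) := by
    intro S hS
    simp only [mem_inter, mem_compl, mem_sdiff] at hS ⊢
    exact ⟨hS.2.2, hS.2⟩
  have key := h n 𝒲 𝒟ᶜ (𝒱 \ 𝒟) 𝒰 h𝒲 hX hY h𝒰 h1 h2
  have hVD' : ∀ S, S ∈ 𝒱 → S ∈ 𝒟 → S ∈ 𝒰 := fun S hv hd => hVD (mem_inter.2 ⟨hv, hd⟩)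
  -- g1: `#(𝒲 ∩ 𝒟ᶜ ∩ (𝒱 \ 𝒟)) + #(𝒲 ∩ 𝒟 ∩ 𝒰) = #(𝒲 ∩ 𝒱)`
  have g1 : #(𝒲 ∩ 𝒟ᶜ ∩ (𝒱 \ 𝒟)) + #(𝒲 ∩ 𝒟 ∩ 𝒰) = #(𝒲 ∩ 𝒱) := by
    rw [← card_union_of_disjoint (disjoint_left.2 fun S ha hb =>
      (mem_compl.1 (mem_inter.1 (mem_inter.1 ha).1).2) (mem_inter.1 (mem_inter.1 hb).1).2)]
    congr 1; ext S; simp only [mem_union, mem_inter, mem_compl, mem_sdiff]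
    constructor
    · rintro (⟨⟨hw, -⟩, hv, -⟩ | ⟨⟨hw, hd⟩, hu⟩)
      · exact ⟨hw, hv⟩
      · exact ⟨hw, hUV hu⟩
    · rintro ⟨hw, hv⟩
      by_cases hd : S ∈ 𝒟
      · exact Or.inr ⟨⟨hw, hd⟩, hVD' S hv hd⟩
      · exact Or.inl ⟨⟨hw, hd⟩, hv, hd⟩
  -- g2: `#(𝒲 ∩ 𝒟ᶜ ∩ 𝒰ᶜˢ) + #(𝒲 ∩ 𝒟 ∩ 𝒰ᶜˢ) = #(𝒲 ∩ 𝒰ᶜˢ)`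
  have g2 : #(𝒲 ∩ 𝒟ᶜ ∩ 𝒰ᶜˢ) + #(𝒲 ∩ 𝒟 ∩ 𝒰ᶜˢ) = #(𝒲 ∩ 𝒰ᶜˢ) := by
    rw [← card_union_of_disjoint (disjoint_left.2 fun S ha hb =>
      (mem_compl.1 (mem_inter.1 (mem_inter.1 ha).1).2) (mem_inter.1 (mem_inter.1 hb).1).2)]
    congr 1; ext S; simp only [mem_union, mem_inter, mem_compl]; tauto
  -- g3: `#(𝒲 ∩ 𝒱ᶜˢ) ≤ #(𝒲 ∩ 𝒰ᶜˢ) + #(𝒲 ∩ ((𝒱 \ 𝒟) \ 𝒰)ᶜˢ)`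
  have g3 : #(𝒲 ∩ 𝒱ᶜˢ) ≤ #(𝒲 ∩ 𝒰ᶜˢ) + #(𝒲 ∩ ((𝒱 \ 𝒟) \ 𝒰)ᶜˢ) := by
    refine (card_le_card ?_).trans (card_union_le _ _)
    intro S hS
    simp only [mem_union, mem_inter, mem_compls, mem_sdiff] at hS ⊢
    obtain ⟨hw, hv⟩ := hS
    by_cases hu : Sᶜ ∈ 𝒰
    · exact Or.inl ⟨hw, hu⟩
    · exact Or.inr ⟨hw, ⟨hv, fun hd => hu (hVD' _ hv hd)⟩, hu⟩
  unfold twoPartN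
  omega

/-- Hence the whole Hall-form tower collapses: `ThreeSetHallD ↔ ThreeSetHallG2`. [this work] -/
theorem threeSetHallD_iff_threeSetHallG2 : ThreeSetHallD ↔ ThreeSetHallG2 :=
  ⟨threeSetHallG2_of_threeSetHallD, threeSetHallD_of_threeSetHallG2⟩

/-- **`ThreeSetHallD → ThreeSetAntipodal`** (this work): the two-up-set core implies the three-set antipodal conjecture (hence SQKD). [this work] -/
theorem threeSetAntipodal_of_threeSetHallD (h : ThreeSetHallD) : ThreeSetAntipodal :=
  threeSetAntipodal_of_threeSetHallG2 (threeSetHallG2_of_threeSetHallD h)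

end Summit.CriticalPhenomena.PercolationContinuityZ3.Theorems.TwoPartition
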